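import Summits.CriticalPhenomena.CardyFormulaZ2.Theorems.CardySelfDualSegmentUniformBoxCrossingDefs2
import Literature.Probability.Percolation.LowestCrossingInterface
import HarnessLib

/-!
# Stub `stub_junction` (crux stmt-CriticalPhenomena-5476 `UniformBoxCrossing`, line `Sketch`):
# recolouring the junction corners changes neither exploration

Bollobás–Riordan 2010 (arXiv:1001.4674), §5.2, "adjusting the colourings of at most two faces",
for the corner models `M_t = cornerPercolation t`. With `ω₁ = cornerConfig S₁`, the lower
region `A = lowerRegion n ω₁` of `S₁ = [0, n]²` (explored from below, `D₁ = dualBelow n ω₁`),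
the upper region `B = upperRegion n s ω₁` of `S₂ = [0, n] × [s, n + s]` (explored from above,
`D₂ = dualAbove n s ω₁`) and the chosen link `q = minimalLink A B W` of the link walk
`W = linkWalk m S₂ X`, the recolouring `recolour` overwrites the coins of the corners deciding the
first and the last edge of `q` so that both edges of each such corner become open
(`mem_cornerConfig_setOn_iff`), and changes no other edge. The claim `stub_junction` is that
`D₁` and `D₂` do not change.

The proof is the following observation. Every step `d = (x, y)` of a link starts outside `B`
and ends outside `A` (`IsLink.fst_notMem`, `IsLink.snd_notMem`), and the face `cornerOf d.edge`
(the face north-east of the corner deciding the edge of `d`) has both `x` and `y` among its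
corners (`cornerOf_mem_facesAt`). Hence this face is neither in the lower hull (`y ∉ A`), so not
in `D₁`, nor — after reflection — in the lower hull of the reflected configuration (`x ∉ B`,
`reflY_pred_mem_facesAt`), so not in `D₂`. But this face is a face of BOTH lattice edges decided
by that corner (`cornerOf_mem_dualEdge`), and opening lattice edges each of which has a face
outside `dualBelow n ω` does not change `dualBelow n ω` (`dualBelow_eq_of_subset`: the new dual
configuration is smaller, and a dual-open path inside `dualBelow n ω` never crosses an opened
edge, both faces of a crossed edge being explored); the same holds for `dualAbove` through the
reflection `upperRefl` (`dualAbove_eq_of_subset`, `dualEdge_map_reflY`).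

## References

* B. Bollobás, O. Riordan, *Percolation on self-dual polygon configurations*, Bolyai Soc. Math.
  Stud. 21 (2010) 131–217, arXiv:1001.4674, §5.2. [BollobasRiordan2010]
-/

noncomputable section

namespace Summit.CriticalPhenomena.CardyFormulaZ2.Cruxes.UniformBoxCrossing.NonSlantLine

open SimpleGraph Finset Literature.Probability Literature.Probability.Percolation
open Literature.Probability.LatticeModels (Site zdGraph setOn mem_setOn_iff)

/-! ### Opening edges with an unexplored face keeps the explored set -/

/-- **Opening lemma.** If `ω ⊆ ω'` and every edge of `ω' \ ω` has a face outside
`dualBelow n ω`, then `dualBelow n ω' = dualBelow n ω`: the dual configuration only shrinks,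
and a dual-open path inside `dualBelow n ω` crosses no edge of `ω' \ ω` (both faces of a crossed
edge lie on the path, hence in `dualBelow n ω`). [cite: BollobasRiordan2010, §5.2] -/
theorem dualBelow_eq_of_subset {n : ℕ} {ω ω' : BondConfig (Site 2)} (hsub : ω ⊆ ω')
    (hface : ∀ e ∈ ω', e ∉ ω → ∃ g ∈ dualEdge e, g ∉ dualBelow n ω) :
    dualBelow n ω' = dualBelow n ω := by
  classical
  ext f
  constructor
  · intro hf
    obtain ⟨hfR, b, hb, hconn⟩ := mem_dualBelow_iff.1 hf
    exact mem_dualBelow_iff.2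
      ⟨hfR, b, hb, isUpperSet_openConnIn _ _ _ (dualConfig_antitone hsub) hconn⟩
  · intro hf
    obtain ⟨b, hb, hconn⟩ := exists_openConnIn_dualBelow hf
    obtain ⟨W, hWS, hWω⟩ := exists_walk_of_mem_openConnIn
      (fun _ h => h.1 : dualConfig ω ⊆ (zdGraph 2).edgeSet) hconn
    have hWω' : ∀ e ∈ W.edges, e ∈ dualConfig ω' := by
      intro e he
      have heω := hWω e he
      rw [mem_dualConfig_iff] at heω ⊢
      refine ⟨heω.1, fun e' he' heq => ?_⟩
      by_cases he'ω : e' ∈ ω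
      · exact heω.2 e' he'ω heq
      · obtain ⟨g, hg, hgD⟩ := hface e' he' he'ω
        rw [heq] at hg
        exact hgD (Finset.mem_coe.1 (hWS g (W.mem_support_of_mem_edges he hg)))
    exact mem_dualBelow_iff.2 ⟨dualBelow_subset hf, b, hb, mem_openConnIn_of_walk W
      (fun z hz => Finset.mem_coe.2 (dualBelow_subset (Finset.mem_coe.1 (hWS z hz)))) hWω'⟩

/-- **Opening lemma, explored from above.** If `ω ⊆ ω' ⊆ E(ℤ²)` and every edge of
`ω' \ ω` has a face outside `dualAbove n s ω`, then `dualAbove n s ω' = dualAbove n s ω`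
(`dualBelow_eq_of_subset` for the reflected configurations; the faces of the reflected edge are
the `reflY (n + s - 1)`-images of the faces of the edge, `dualEdge_map_reflY`).
[cite: BollobasRiordan2010, §5.2] -/
theorem dualAbove_eq_of_subset {n s : ℕ} {ω ω' : BondConfig (Site 2)} (hsub : ω ⊆ ω')
    (hE : ω' ⊆ (zdGraph 2).edgeSet)
    (hface : ∀ e ∈ ω', e ∉ ω → ∃ g ∈ dualEdge e, g ∉ dualAbove n s ω) :
    dualAbove n s ω' = dualAbove n s ω := by
  unfold dualAbove
  congr 1
  refine dualBelow_eq_of_subset (fun e he => ?_) (fun e he hne => ?_)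
  · rw [mem_reflConfig_iff] at he ⊢
    exact hsub he
  · rw [mem_reflConfig_iff] at he
    have hne' : e.map (upperRefl n s) ∉ ω := fun h => hne ((mem_reflConfig_iff n s ω e).2 h)
    obtain ⟨g, hg, hgA⟩ := hface _ he hne'
    have heE : e ∈ (zdGraph 2).edgeSet := (map_reflY_mem_edgeSet_iff _ e).1 (hE he)
    have hde : dualEdge (e.map (upperRefl n s)) = (dualEdge e).map (reflY ((n : ℤ) + s - 1)) :=
      dualEdge_map_reflY ((n : ℤ) + s) heE
    rw [hde, Sym2.mem_map] at hg
    obtain ⟨g₀, hg₀, rfl⟩ := hg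
    exact ⟨g₀, hg₀, fun hg₀D => hgA (Finset.mem_image_of_mem _ hg₀D)⟩

/-! ### Faces of an edge, faces around a vertex, and the reflection -/

/-- The corner of the lattice edge `{u, u + eᵢ}` is `u`. [folklore] -/
theorem cornerOf_mk_add_single (u : Site 2) (i : Fin 2) : cornerOf s(u, u + Pi.single i 1) = u :=
  cornerOf_cornerEdge (u, i)

/-- The face north-east of the corner of a lattice edge is one of the two faces of the edge
(`dualEdge_horizontal`, `dualEdge_vertical`). [folklore] -/
theorem cornerOf_mem_dualEdge {e : Sym2 (Site 2)} (he : e ∈ (zdGraph 2).edgeSet) :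
    cornerOf e ∈ dualEdge e := by
  obtain ⟨u, hi⟩ := mem_edgeSet_zdGraph_iff.1 he
  rcases Fin.exists_fin_two.1 hi with rfl | rfl
  · rw [cornerOf_mk_add_single, dualEdge_horizontal]; exact Sym2.mem_mk_right _ _
  · rw [cornerOf_mk_add_single, dualEdge_vertical]; exact Sym2.mem_mk_right _ _

/-- The face north-east of the corner of a lattice edge has both endpoints of the edge among its
corners. [folklore] -/
theorem cornerOf_mem_facesAt {e : Sym2 (Site 2)} (he : e ∈ (zdGraph 2).edgeSet) {x : Site 2}
    (hx : x ∈ e) : cornerOf e ∈ facesAt x := by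
  obtain ⟨u, hi⟩ := mem_edgeSet_zdGraph_iff.1 he
  rw [mem_facesAt_iff']
  rcases Fin.exists_fin_two.1 hi with rfl | rfl
  · rw [cornerOf_mk_add_single]
    rcases Sym2.mem_iff.1 hx with rfl | rfl
    · exact Or.inl rfl
    · exact Or.inr (Or.inl rfl)
  · rw [cornerOf_mk_add_single]
    rcases Sym2.mem_iff.1 hx with rfl | rfl
    · exact Or.inl rfl
    · exact Or.inr (Or.inr (Or.inl rfl))

/-- The faces around the reflected vertex `reflY c v` are the `reflY (c - 1)`-images of the faces
around `v` (`reflY (c - 1)` on faces realises `reflY c` on the lattice). [folklore] -/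
theorem reflY_pred_mem_facesAt (c : ℤ) {v g : Site 2} (hg : g ∈ facesAt v) :
    reflY (c - 1) g ∈ facesAt (reflY c v) := by
  rw [mem_facesAt_iff] at hg ⊢
  simp only [LatticeModels.Site.eq_iff_two, reflY_apply_zero, reflY_apply_one, Pi.sub_apply,
    single_zero_apply_zero, single_zero_apply_one, single_one_apply_zero,
    single_one_apply_one] at hg ⊢
  omega

/-! ### The recoloured configuration -/

/-- **The recoloured corner configuration, edge by edge.** Overwriting the coins of the corners
in `J` by the pattern `(c, d) = (1, 0)` opens both edges of every corner of `J`
(`c = 1`: east edge open; `c ≠ d`: north edge open) and leaves every other edge as it was.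
[cite: BollobasRiordan2010, §5.2] -/
theorem cornerEdge_mem_cornerConfig_setOn_iff (J : Finset (Site 2)) (S : Set (Site 2 × Fin 2))
    (i : Site 2 × Fin 2) :
    Percolation.cornerEdge i ∈
        cornerConfig (setOn (J ×ˢ Finset.univ) ↑(J ×ˢ ({0} : Finset (Fin 2))) S) ↔
      i.1 ∈ J ∨ Percolation.cornerEdge i ∈ cornerConfig S := by
  obtain ⟨v, j⟩ := i
  rw [cornerEdge_mem_cornerConfig_iff, cornerEdge_mem_cornerConfig_iff]
  by_cases h : v ∈ J
  · have hmem : ∀ k : Fin 2,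
        (v, k) ∈ setOn (J ×ˢ Finset.univ) ↑(J ×ˢ ({0} : Finset (Fin 2))) S ↔ k = 0 := by
      intro k
      rw [mem_setOn_iff, Finset.mem_coe, Finset.mem_product, Finset.mem_product,
        Finset.mem_singleton]
      simp [h]
    simp only [h, true_or, iff_true]
    fin_cases j
    · simp only [Fin.zero_eta, cornerBit_zero, hmem]
    · simp only [Fin.mk_one, cornerBit_one, hmem]
      decide
  · have hmem : ∀ k : Fin 2,
        (v, k) ∈ setOn (J ×ˢ Finset.univ) ↑(J ×ˢ ({0} : Finset (Fin 2))) S ↔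
          (v, k) ∈ S := by
      intro k
      rw [mem_setOn_iff]
      simp [h]
    simp only [h, false_or, hmem]

/-- The recoloured corner configuration: an edge is open iff it was open or it is a lattice edge
decided by a corner of `J`. [cite: BollobasRiordan2010, §5.2] -/
theorem mem_cornerConfig_setOn_iff (J : Finset (Site 2)) (S : Set (Site 2 × Fin 2))
    (e : Sym2 (Site 2)) :
    e ∈ cornerConfig (setOn (J ×ˢ Finset.univ) ↑(J ×ˢ ({0} : Finset (Fin 2))) S) ↔
      e ∈ cornerConfig S ∨ (e ∈ (zdGraph 2).edgeSet ∧ cornerOf e ∈ J) := by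
  by_cases he : e ∈ (zdGraph 2).edgeSet
  · obtain ⟨i, rfl⟩ := mem_edgeSet_iff_exists_cornerEdge.1 he
    rw [cornerEdge_mem_cornerConfig_setOn_iff, cornerOf_cornerEdge]
    tauto
  · constructor
    · exact fun h => absurd (cornerConfig_subset_edgeSet _ h) he
    · rintro (h | ⟨h, -⟩)
      · exact absurd (cornerConfig_subset_edgeSet _ h) he
      · exact absurd h he

/-! ### The junction corners are corners of steps of the link -/

/-- Every end corner of a walk is the corner of the edge of one of its darts. [folklore] -/
theorem exists_dart_of_mem_endCorners {q : XWalk} {z : Site 2} (hz : z ∈ endCorners q) :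
    ∃ d ∈ q.walk.darts, cornerOf d.edge = z := by
  unfold endCorners at hz
  rw [List.mem_toFinset, List.mem_append] at hz
  rcases hz with hz | hz
  · cases hh : q.walk.darts.head? with
    | none => rw [hh] at hz; simp at hz
    | some d =>
      rw [hh] at hz
      simp only [Option.map_some, Option.toList_some, List.mem_singleton] at hz
      exact ⟨d, List.mem_of_mem_head? hh, hz.symm⟩
  · cases hh : q.walk.darts.getLast? with
    | none => rw [hh] at hz; simp at hz
    | some d =>
      rw [hh] at hz
      simp only [Option.map_some, Option.toList_some, List.mem_singleton] at hz
      exact ⟨d, List.mem_of_getLast? hh, hz.symm⟩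

/-- **The face at a step of a link is unexplored from both sides.** For a dart `d` of a link from
`A = lowerRegion n ω` to `B = upperRegion n s ω`, the face `cornerOf d.edge` lies neither in
`dualBelow n ω` (its corner `d.snd` is outside `A`, so no face around it is in the lower hull)
nor in `dualAbove n s ω` (its corner `d.fst` is outside `B`). [cite: BollobasRiordan2010, §5.2] -/
theorem cornerOf_dart_notMem {n s : ℕ} {ω : BondConfig (Site 2)} {w q : XWalk}
    (hq : IsLink (lowerRegion n ω) (upperRegion n s ω) w q) {d : (zdGraph 2).Dart}
    (hd : d ∈ q.walk.darts) :
    cornerOf d.edge ∉ dualBelow n ω ∧ cornerOf d.edge ∉ dualAbove n s ω := by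
  have hE : d.edge ∈ (zdGraph 2).edgeSet := d.edge_mem
  have hfst : d.fst ∈ d.edge := Sym2.mem_mk_left _ _
  have hsnd : d.snd ∈ d.edge := Sym2.mem_mk_right _ _
  constructor
  · intro hD
    refine hq.snd_notMem d hd ((mem_lowerRegion_iff n).2 (Or.inr ?_))
    exact ⟨cornerOf d.edge, cornerOf_mem_facesAt hE hsnd, dualBelow_subset_lowerHull n ω hD⟩
  · intro hD
    obtain ⟨g, hg, hgz⟩ := Finset.mem_image.1 hD
    refine hq.fst_notMem d hd ((mem_upperRegion_iff n s).2 ((mem_lowerRegion_iff n).2 (Or.inr ?_)))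
    refine ⟨reflY ((n : ℤ) + s - 1) (cornerOf d.edge),
      reflY_pred_mem_facesAt ((n : ℤ) + s) (cornerOf_mem_facesAt hE hfst),
      dualBelow_subset_lowerHull n _ ?_⟩
    rw [← hgz, reflY_reflY]
    exact hg

/-! ### The stub -/

/-- **Junction invariance** (Bollobás–Riordan 2010, §5.2, "adjusting the colourings of at most
two faces", for the corner model): overwriting the coins of the junction corners of the link by
the pattern opening both of their edges changes neither the exploration of `S₁ = [0, n]²` from
below nor the exploration of `S₂ = [0, n] × [s, n + s]` from above. (The hypotheses
`1 ≤ s ≤ n` and the disjointness of the two regions are part of the registered signature but are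
not needed: the steps of a link start outside `B` and end outside `A` by definition.)
[cite: BollobasRiordan2010, §5.2] -/
theorem stub_junction : JunctionStatement := by
  intro n s m S₁ S₂ X _ _ _ hA hB
  set J := juncCorners n s m (S₁, S₂, X)
  have hlink : IsLink (lowerRegion n (cornerConfig S₁)) (upperRegion n s (cornerConfig S₁))
      (linkWalk m S₂ X) (minimalLink (lowerRegion n (cornerConfig S₁))
        (upperRegion n s (cornerConfig S₁)) (linkWalk m S₂ X)) :=
    isLink_minimalLink hA hB
  have hJ' : J = endCorners (minimalLink (lowerRegion n (cornerConfig S₁))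
      (upperRegion n s (cornerConfig S₁)) (linkWalk m S₂ X)) := rfl
  have key : ∀ z ∈ J,
      z ∉ dualBelow n (cornerConfig S₁) ∧ z ∉ dualAbove n s (cornerConfig S₁) := by
    intro z hz
    rw [hJ'] at hz
    obtain ⟨d, hd, rfl⟩ := exists_dart_of_mem_endCorners hz
    exact cornerOf_dart_notMem hlink hd
  have hrec : (recolour n s m (S₁, S₂, X)).1 =
      setOn (J ×ˢ Finset.univ) ↑(J ×ˢ ({0} : Finset (Fin 2))) S₁ := rfl
  have hsub : cornerConfig S₁ ⊆ cornerConfig (recolour n s m (S₁, S₂, X)).1 := by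
    rw [hrec]
    exact fun e he => (mem_cornerConfig_setOn_iff J S₁ e).2 (Or.inl he)
  have hdiff : ∀ e ∈ cornerConfig (recolour n s m (S₁, S₂, X)).1,
      e ∉ cornerConfig S₁ → e ∈ (zdGraph 2).edgeSet ∧ cornerOf e ∈ J := by
    intro e he hne
    rw [hrec, mem_cornerConfig_setOn_iff] at he
    exact he.resolve_left hne
  constructor
  · refine dualBelow_eq_of_subset hsub fun e he hne => ?_
    obtain ⟨heE, hcJ⟩ := hdiff e he hne
    exact ⟨cornerOf e, cornerOf_mem_dualEdge heE, (key _ hcJ).1⟩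
  · refine dualAbove_eq_of_subset hsub (cornerConfig_subset_edgeSet _) fun e he hne => ?_
    obtain ⟨heE, hcJ⟩ := hdiff e he hne
    exact ⟨cornerOf e, cornerOf_mem_dualEdge heE, (key _ hcJ).2⟩

end Summit.CriticalPhenomena.CardyFormulaZ2.Cruxes.UniformBoxCrossing.NonSlantLine
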